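import Summits.QuantumFields.YangMills.Theorems.BalabanUVNodesPortS1G3CWalkSum

/-!
# NODE O port PT-A — `stub_G3C` (repaired edition `G3CAtRecordL`), layer (β′): THE ONE-STEP SUM `Σ_s f(a; s) ≤ Λ(c, γ, δ₀, κ′, κt, Mc)` — pure torus combinatorics (symmetry of `□̃`,
# `#{□ : Y ∩ □̃ ≠ ∅} ≤ 81²·#Y`, `#Y ≤ 80·e^{d_j(Y)}`, (1.26)) — and the THRESHOLDS `δG(κt, c, γ)`, `Mth'(κt, c, γ, κ′)` making `Λ ≤ ½` («κ can be arbitrarily large if M is sufficiently large»)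

Cell `ym-nodeO-ideate`, porter hand `hand-27930-G3C` (g1); `--supports stmt-QuantumFields-27930`; count-neutral.  [16] = [Balaban1985UV3], [B9] = [Balaban1985BackgroundPropagators],
[I] = [Balaban1987RG1], [II] = [Balaban1988RG2Cluster].

WHY ([16] p.262 after (25); memo §5c «Per-step ratio λ … choose δG, Mth' with λ ≤ ½»).  The path-sum lemma of ✓`…G3CWalkSum` turns the walk expansion into a geometric series in `Λ`, any bound of
the one-step sums `Σ_{(□,Y)} f(a; □, Y)` of the step weight.  Here `Λ` is computed: for fixed `Y ∋ a`, the cubes `□` with `Y ∩ □̃ ≠ ∅` number at most `81²·#Y` (`□̃`-membership is symmetric on the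
torus), `#Y ≤ 2^4(4d_j(Y)+1) ≤ 80·e^{d_j(Y)}` (✓`card_le_torusTreeLen`); a FAR piece (`d_j(Y) ≥ 1`) then weighs `≤ (c/γ)·e^{κt(9^4+4)}·e^{−(δ₀−κt−1−κ₀)}·e^{−κ₀ d_j(Y)}`, a NEAR piece
(`d_j(Y) < 1`) `≤ e^{κt(9^4+4)}·e^{1+κ₀}·c·3^8·12(L·Mc)^4·e^{−κ′·L·Mc}·(2/γ)·e^{−κ₀ d_j(Y)}`, and (1.26) `Σ_{Y ∋ a} e^{−κ₀ d_j(Y)} ≤ K₀` (✓`G3CGeom.sum_ite_mem_le`) gives `Λ = g3cLam`.  Then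
`δ₀ ≥ δG := κ₀ + κt + 1 + 4A` kills the far half (`A·e^{−4A} ≤ ¼` by `e^x ≥ 1 + x`) and `Mc ≥ Mth'` the near half (`y^4 e^{−y} ≤ 120/y`, ✓`Real.pow_div_factorial_le_exp`).

WHAT THIS FILE PROVES (sorry-free): `G3CGeom.mem_tblock_comm` (the cover argument of ✓`NE1p…proj_mem_tblock`, inlined — that module's oleans are not on the farm), `G3CGeom.mem_blk_comm`, `G3CGeom.card_filter_meets_le`, `G3CGeom.card_le_exp_torusTreeLen`; definition `g3cLam`;
`g3cStepBd_le`, `sum_g3cStepWt_snd_le`, ★★`sum_g3cStepWt_le` (`Σ_s f(a; s) ≤ g3cLam`); ★`exists_thresholds_g3cLam` (`∃ δG > 0, ∃ Mth', δ₀ ≥ δG → Mc ≥ Mth' → g3cLam ≤ ½ ∧ κ₀ + κt + 1 ≤ δ₀`).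

HONEST FRAMING.  Torus combinatorics and real-number bookkeeping; nothing of Bałaban asserted, ported or discharged; `stub_G3C` NOT closed; 27930 OPEN; NODE O 0∕1; COUNT 8∕28 · K 1∕4 UNMOVED;
finite `𝕋⁴_{L^K}` at fixed ε — NOT continuum ∕ OS ∕ Clay; **the Yang–Mills mass gap is NOT proved by any of this.**  No `sorry`, no `instance`, no `notation`; standard axioms.
-/

noncomputable section

open scoped BigOperators Matrix.Norms.L2Operator Topology Matrix Classical
open Filter Finset

/-! ## §1  Torus geometry: `□̃`-membership is symmetric; counting the cubes whose block meets `Y` -/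

namespace Summit.QuantumFields.YangMills.Theorems.BalabanUVNodesPortS1.G3CGeom

open Literature.MathematicalPhysics.QuantumFieldTheory.Balaban1983to89
open Literature.MathematicalPhysics.QuantumFieldTheory.Balaban1983to89.TreeLengthTorus
open Literature.MathematicalPhysics.QuantumFieldTheory.Balaban1983to89.TreeLengthTorusGeometry
open Literature.MathematicalPhysics.QuantumFieldTheory.Balaban1983to89.TreeLengthTorusTransfer
open Literature.MathematicalPhysics.QuantumFieldTheory.Balaban1983to89.B13ScaleTransfer (Pt block mem_block)

variable {d N : ℕ} [NeZero N]

/-- **`□̃`-membership is symmetric on the torus**: `b ∈ tblock a ⟹ a ∈ tblock b`. [folklore] -/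
theorem mem_tblock_comm {a b : TPt d N} (h : b ∈ tblock a) : a ∈ tblock b := by
  -- `b = proj y` with `y ∈ block (natLift a)`; then `natLift a ∈ block y` (symmetry on the cover) and we translate `natLift a` by the period taking `y` to `natLift b`
  obtain ⟨y, hy, rfl⟩ := Finset.mem_image.1 h
  have hsymm : natLift a ∈ block y := by
    rw [mem_block] at hy ⊢
    intro i
    obtain ⟨h1, h2⟩ := hy i
    exact ⟨by linarith, by linarith⟩
  obtain ⟨kk, hk⟩ := exists_period_of_proj_eq (proj_natLift (proj N y)).symm
  unfold tblock
  rw [Finset.mem_image]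
  refine ⟨natLift a + period N kk, ?_, by rw [proj_add_period, proj_natLift]⟩
  rw [hk, mem_block]
  rw [mem_block] at hsymm
  intro i
  obtain ⟨h1, h2⟩ := hsymm i
  simp only [Pi.add_apply]
  exact ⟨by linarith, by linarith⟩

/-- **The `5^d`-block relation is symmetric**: `c ∈ tcollar (tblock a) ⟹ a ∈ tcollar (tblock c)`. [folklore] -/
theorem mem_blk_comm {a c : TPt d N} (h : c ∈ tcollar (tblock a)) : a ∈ tcollar (tblock c) := by
  rw [tcollar, Finset.mem_biUnion] at h ⊢
  obtain ⟨b, hb, hcb⟩ := h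
  exact ⟨b, mem_tblock_comm hcb, mem_tblock_comm hb⟩

/-- **The cubes whose `5^d` block meets `Y` number at most `9^d·#Y`.** [folklore] -/
theorem card_filter_meets_le (Y : Finset (TPt d N)) :
    ((Finset.univ : Finset (TPt d N)).filter fun q => (Y ∩ tcollar (tblock q)).Nonempty).card ≤ 3 ^ d * 3 ^ d * Y.card := by
  calc ((Finset.univ : Finset (TPt d N)).filter fun q => (Y ∩ tcollar (tblock q)).Nonempty).card
      ≤ (Y.biUnion fun c => tcollar (tblock c)).card := by
        refine Finset.card_le_card fun q hq => ?_
        rw [Finset.mem_filter] at hq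
        obtain ⟨c, hc⟩ := hq.2
        rw [Finset.mem_inter] at hc
        exact Finset.mem_biUnion.2 ⟨c, hc.1, mem_blk_comm hc.2⟩
    _ ≤ ∑ c ∈ Y, (tcollar (tblock c)).card := Finset.card_biUnion_le
    _ ≤ ∑ c ∈ Y, 3 ^ d * 3 ^ d := Finset.sum_le_sum fun c _ => (card_tcollar_le _).trans (Nat.mul_le_mul_left _ (card_tblock_le c))
    _ = 3 ^ d * 3 ^ d * Y.card := by rw [Finset.sum_const, smul_eq_mul, mul_comm]

/-- **Volume against tree length, exponential form**: `#Y ≤ 2^d·5·e^{d_j(Y)}` for a domain `Y` (`4t + 1 ≤ 5e^t`). [cite: Balaban1988RG2Cluster, (2.27) p.18 (volume vs d_j)] -/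
theorem card_le_exp_torusTreeLen {Y : Finset (TPt d N)} (hY : Y.Nonempty) (hc : TFaceConnected Y) :
    (Y.card : ℝ) ≤ 2 ^ d * 5 * Real.exp (torusTreeLen Y) := by
  have h := card_le_torusTreeLen hY hc
  have h0 := torusTreeLen_nonneg Y
  have h1 : 4 * torusTreeLen Y + 1 ≤ 5 * Real.exp (torusTreeLen Y) := by
    have := Real.add_one_le_exp (torusTreeLen Y); nlinarith
  calc (Y.card : ℝ) ≤ 2 ^ d * (4 * torusTreeLen Y + 1) := h
    _ ≤ 2 ^ d * (5 * Real.exp (torusTreeLen Y)) := mul_le_mul_of_nonneg_left h1 (by positivity)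
    _ = 2 ^ d * 5 * Real.exp (torusTreeLen Y) := by ring

end Summit.QuantumFields.YangMills.Theorems.BalabanUVNodesPortS1.G3CGeom

namespace Summit.QuantumFields.YangMills.Theorems.BalabanUVNodesPortS1

open Summit.QuantumFields.YangMills.Theorems.K0RecordFormatNames
open Literature.MathematicalPhysics.QuantumFieldTheory.Balaban1983to89
open Literature.MathematicalPhysics.QuantumFieldTheory.Balaban1983to89.Node00
open Literature.MathematicalPhysics.QuantumFieldTheory.Balaban1983to89.T4Continuum (T4Family)
open Literature.MathematicalPhysics.QuantumFieldTheory.Balaban1983to89.TreeLengthTorus (TPt IsTDom TFaceConnected torusTreeLen torusTreeLen_nonneg)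
open Literature.MathematicalPhysics.QuantumFieldTheory.Balaban1983to89.TreeLengthTorusTransfer (tblock tcollar)
open Literature.MathematicalPhysics.QuantumFieldTheory.Balaban1983to89.B12TreeDecay (K₀ kappa₀ K₀_pos kappa₀_nonneg)

/-! ## §2  The one-step constant `Λ` -/

section Lam

variable (F : T4Family)

/-- ★ **`Λ(c, γ, δ₀, κ′, κt, Mc)` — the one-step sum bound of the walk expansion** (far half `∝ e^{−(δ₀−κt−1−κ₀)}`, near half `∝ (L·Mc)^4·e^{−κ′·L·Mc}`; `κ₀ = kappa₀(64,8)`):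
`K₀·(81²·80)·e^{κt(81²+4)}·[(c/γ)·e^{−(δ₀−κt−1−κ₀)} + e^{1+κ₀}·c·3^8·12(L·Mc)^4·e^{−κ′·L·Mc}/(γ/2)]`. [cite: Balaban1985UV3, (25) p.262; Balaban1985BackgroundPropagators, (3.96) p.411] -/
def g3cLam (Mc : ℕ) (c γ δ₀ κ' κt : ℝ) : ℝ :=
  K₀ (4 * 2 ^ 4) (2 * 4) * (((3 ^ 4 * 3 ^ 4 : ℕ) : ℝ) * (2 ^ 4 * 5)) * Real.exp (κt * (((3 ^ 4 * 3 ^ 4 : ℕ) : ℝ) + 4)) *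
    (c * (1 / γ) * Real.exp (-(δ₀ - κt - 1 - kappa₀ (4 * 2 ^ 4) (2 * 4))) +
      Real.exp (1 + kappa₀ (4 * 2 ^ 4) (2 * 4)) *
        (c * (((3 ^ 4 * 3 ^ 4 * (3 * 4 * (F.L * Mc) ^ 4) : ℕ) : ℝ) * (Real.exp (-(κ' * ((F.L * Mc : ℕ) : ℝ))) / (γ / 2)))))

end Lam

section StepSum

variable {F : T4Family}

/-- The step bound is at most its `□`-free envelope `G(Y)`: far `c·e^{−δ₀d_j(Y)}/γ`, near `c·3^8·12(L·Mc)^4·e^{−κ′LMc}/(γ/2)` (`δ₀ ≥ 0`). [folklore] -/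
theorem g3cStepBd_le (Mc k K : ℕ) {c γ δ₀ : ℝ} (κ' : ℝ) (hc : 0 ≤ c) (hγ : 0 < γ) (hδ₀ : 0 ≤ δ₀)
    (s : TPt (F.P K).d (Sect2.domCount (F.P K) Mc (k + 1)) × (recordDomSys F Mc k K).Dom) :
    g3cStepBd F Mc k K c γ δ₀ κ' s ≤
      if 1 ≤ (recordDomSys F Mc k K).dj s.2 then c * Real.exp (-(δ₀ * (recordDomSys F Mc k K).dj s.2)) * (1 / γ)
      else c * (((3 ^ 4 * 3 ^ 4 * (3 * 4 * (F.L * Mc) ^ 4) : ℕ) : ℝ) * (Real.exp (-(κ' * ((F.L * Mc : ℕ) : ℝ))) / (γ / 2))) := by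
  have hdj : 0 ≤ (recordDomSys F Mc k K).dj s.2 := (recordDomSys F Mc k K).dj_nonneg s.2
  unfold g3cStepBd
  by_cases hsub : (s.2.1 : Finset _) ⊆ (g3cBlk F Mc k K s.1).1
  · rw [if_pos hsub]; split_ifs <;> positivity
  · rw [if_neg hsub]
    by_cases hfar : 1 ≤ (recordDomSys F Mc k K).dj s.2
    · rw [if_pos hfar, if_pos hfar]
    · rw [if_neg hfar, if_neg hfar]
      have h1 : Real.exp (-(δ₀ * (recordDomSys F Mc k K).dj s.2)) ≤ 1 := Real.exp_le_one_iff.2 (by nlinarith)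
      have h2 : 0 ≤ (((3 ^ 4 * 3 ^ 4 * (3 * 4 * (F.L * Mc) ^ 4) : ℕ) : ℝ) * (Real.exp (-(κ' * ((F.L * Mc : ℕ) : ℝ))) / (γ / 2))) := by positivity
      calc c * Real.exp (-(δ₀ * (recordDomSys F Mc k K).dj s.2)) * _ ≤ c * 1 * _ :=
            mul_le_mul_of_nonneg_right (mul_le_mul_of_nonneg_left h1 hc) h2
        _ = _ := by rw [mul_one]

/-- **The one-step sum at fixed `Y`**: `Σ_□ f(a; □, Y) ≤ 𝟙[a ∈ Y]·e^{−κ₀ d_j(Y)}·M` with `M·K₀ = Λ`. [cite: Balaban1985UV3, (25) p.262; Balaban1988RG2Cluster, (1.26) p.8, (2.27) p.18] -/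
theorem sum_g3cStepWt_snd_le (Mc k K : ℕ) {c γ δ₀ κt : ℝ} (κ' : ℝ) (hc : 0 ≤ c) (hγ : 0 < γ) (hκt : 0 ≤ κt)
    (hδ₀ : kappa₀ (4 * 2 ^ 4) (2 * 4) + κt + 1 ≤ δ₀) (a : TPt (F.P K).d (Sect2.domCount (F.P K) Mc (k + 1))) (Y : (recordDomSys F Mc k K).Dom) :
    ∑ q : TPt (F.P K).d (Sect2.domCount (F.P K) Mc (k + 1)), g3cStepWt F Mc k K c γ δ₀ κ' κt a (q, Y) ≤
      (if a ∈ (Y.1 : Finset _) then Real.exp (-(kappa₀ (4 * 2 ^ 4) (2 * 4) * torusTreeLen (Y.1 : Finset _))) else 0) *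
        ((((3 ^ 4 * 3 ^ 4 : ℕ) : ℝ) * (2 ^ 4 * 5)) * Real.exp (κt * (((3 ^ 4 * 3 ^ 4 : ℕ) : ℝ) + 4)) *
          (c * (1 / γ) * Real.exp (-(δ₀ - κt - 1 - kappa₀ (4 * 2 ^ 4) (2 * 4))) +
            Real.exp (1 + kappa₀ (4 * 2 ^ 4) (2 * 4)) *
              (c * (((3 ^ 4 * 3 ^ 4 * (3 * 4 * (F.L * Mc) ^ 4) : ℕ) : ℝ) * (Real.exp (-(κ' * ((F.L * Mc : ℕ) : ℝ))) / (γ / 2)))))) := by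
  -- names
  set κ₀ : ℝ := kappa₀ (4 * 2 ^ 4) (2 * 4) with hκ₀def
  have hκ₀ : 0 ≤ κ₀ := kappa₀_nonneg (by norm_num) _
  have hδ₀0 : 0 ≤ δ₀ := by linarith
  set t : ℝ := torusTreeLen (Y.1 : Finset _) with htdef
  have ht0 : 0 ≤ t := torusTreeLen_nonneg _
  have hdj : (recordDomSys F Mc k K).dj Y = t := rfl
  set CB : ℝ := ((3 ^ 4 * 3 ^ 4 : ℕ) : ℝ) with hCBdef
  have hCBd : (((3 ^ (F.P K).d * 3 ^ (F.P K).d : ℕ) : ℝ)) = CB := by simp [hCBdef, T4Family.P_d]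
  set Nn : ℝ := (((3 ^ 4 * 3 ^ 4 * (3 * 4 * (F.L * Mc) ^ 4) : ℕ) : ℝ) * (Real.exp (-(κ' * ((F.L * Mc : ℕ) : ℝ))) / (γ / 2))) with hNndef
  have hNn0 : 0 ≤ Nn := by positivity
  set Afar : ℝ := c * (1 / γ) * Real.exp (-(δ₀ - κt - 1 - κ₀)) with hAfar
  set Anear : ℝ := Real.exp (1 + κ₀) * (c * Nn) with hAnear
  have hAfar0 : 0 ≤ Afar := by positivity
  have hAnear0 : 0 ≤ Anear := by positivity
  -- the envelope `G(Y)` and the count of `□`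
  set G : ℝ := if 1 ≤ t then c * Real.exp (-(δ₀ * t)) * (1 / γ) else c * Nn with hGdef
  have hG0 : 0 ≤ G := by rw [hGdef]; split_ifs <;> positivity
  have hbd : ∀ q, g3cStepBd F Mc k K c γ δ₀ κ' (q, Y) ≤ G := fun q => by
    have := g3cStepBd_le (F := F) Mc k K κ' hc hγ hδ₀0 (q, Y)
    simpa only [hGdef, hdj] using this
  have hE : ∀ q, g3cStepWt F Mc k K c γ δ₀ κ' κt a (q, Y) ≤
      (if a ∈ (Y.1 : Finset _) then (1 : ℝ) else 0) * (if ((Y.1 : Finset _) ∩ (g3cBlk F Mc k K q).1).Nonempty then (1 : ℝ) else 0) *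
        (G * Real.exp (κt * (t + (CB + 3)))) := by
    intro q
    rw [g3cStepWt, hdj, hCBd]
    refine mul_le_mul_of_nonneg_left (mul_le_mul_of_nonneg_right (hbd q) (Real.exp_pos _).le) ?_
    refine mul_nonneg ?_ ?_ <;> split_ifs <;> norm_num
  by_cases ha : a ∈ (Y.1 : Finset _)
  swap
  · rw [if_neg ha, zero_mul]
    refine (Finset.sum_le_sum fun q _ => hE q).trans ?_
    simp only [if_neg ha, zero_mul, Finset.sum_const_zero, le_refl]
  rw [if_pos ha]
  -- Σ_q ≤ (#meeting cubes)·G·E ≤ 81²·#Y·G·E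
  have hcount : (((Finset.univ : Finset (TPt (F.P K).d (Sect2.domCount (F.P K) Mc (k + 1)))).filter fun q =>
      ((Y.1 : Finset _) ∩ (g3cBlk F Mc k K q).1).Nonempty).card : ℝ) ≤ CB * (Y.1 : Finset _).card := by
    have h := G3CGeom.card_filter_meets_le (d := (F.P K).d) (N := Sect2.domCount (F.P K) Mc (k + 1)) (Y.1 : Finset _)
    have h' : (((Finset.univ : Finset (TPt (F.P K).d (Sect2.domCount (F.P K) Mc (k + 1)))).filter fun q =>
        ((Y.1 : Finset _) ∩ tcollar (tblock q)).Nonempty).card : ℝ) ≤ ((3 ^ (F.P K).d * 3 ^ (F.P K).d : ℕ) : ℝ) * (Y.1 : Finset _).card := by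
      exact_mod_cast h
    rw [hCBd] at h'
    exact h'
  have hsum1 : ∑ q : TPt (F.P K).d (Sect2.domCount (F.P K) Mc (k + 1)), g3cStepWt F Mc k K c γ δ₀ κ' κt a (q, Y) ≤
      CB * (Y.1 : Finset _).card * (G * Real.exp (κt * (t + (CB + 3)))) := by
    have hind : ∑ q : TPt (F.P K).d (Sect2.domCount (F.P K) Mc (k + 1)),
        (if ((Y.1 : Finset _) ∩ (g3cBlk F Mc k K q).1).Nonempty then (1 : ℝ) else 0) =
        (((Finset.univ : Finset (TPt (F.P K).d (Sect2.domCount (F.P K) Mc (k + 1)))).filter fun q =>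
          ((Y.1 : Finset _) ∩ (g3cBlk F Mc k K q).1).Nonempty).card : ℝ) := Finset.sum_boole _ _
    calc ∑ q : TPt (F.P K).d (Sect2.domCount (F.P K) Mc (k + 1)), g3cStepWt F Mc k K c γ δ₀ κ' κt a (q, Y)
        ≤ ∑ q : TPt (F.P K).d (Sect2.domCount (F.P K) Mc (k + 1)),
            (if ((Y.1 : Finset _) ∩ (g3cBlk F Mc k K q).1).Nonempty then (1 : ℝ) else 0) * (G * Real.exp (κt * (t + (CB + 3)))) := by
          refine Finset.sum_le_sum fun q _ => (hE q).trans (le_of_eq ?_)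
          rw [if_pos ha, one_mul]
      _ = (((Finset.univ : Finset (TPt (F.P K).d (Sect2.domCount (F.P K) Mc (k + 1)))).filter fun q =>
          ((Y.1 : Finset _) ∩ (g3cBlk F Mc k K q).1).Nonempty).card : ℝ) * (G * Real.exp (κt * (t + (CB + 3)))) := by
          rw [← Finset.sum_mul, hind]
      _ ≤ CB * (Y.1 : Finset _).card * (G * Real.exp (κt * (t + (CB + 3)))) := mul_le_mul_of_nonneg_right hcount (by positivity)
  -- #Y ≤ 80 e^t
  have hcard : ((Y.1 : Finset _).card : ℝ) ≤ 2 ^ 4 * 5 * Real.exp t := by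
    rw [htdef]
    have h := G3CGeom.card_le_exp_torusTreeLen (d := (F.P K).d) Y.2.1 Y.2.2
    have h4 : (2 : ℝ) ^ (F.P K).d = 2 ^ 4 := by rw [T4Family.P_d]
    rw [h4] at h
    exact h
  -- the two cases for `G`
  have hkey : (2 ^ 4 * 5 * Real.exp t) * (G * Real.exp (κt * (t + (CB + 3)))) ≤
      Real.exp (-(κ₀ * t)) * ((2 ^ 4 * 5) * Real.exp (κt * (CB + 4)) * (Afar + Anear)) := by
    rw [hGdef]
    split_ifs with hfar
    · -- far: exponent bookkeeping `t + (−δ₀ t) + κt(t + CB + 3) ≤ −κ₀ t + κt(CB+4) − (δ₀ − κt − 1 − κ₀)`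
      have hexp : Real.exp t * (Real.exp (-(δ₀ * t)) * Real.exp (κt * (t + (CB + 3)))) ≤
          Real.exp (-(κ₀ * t)) * (Real.exp (κt * (CB + 4)) * Real.exp (-(δ₀ - κt - 1 - κ₀))) := by
        rw [← Real.exp_add, ← Real.exp_add, ← Real.exp_add, ← Real.exp_add]
        apply Real.exp_le_exp.2
        nlinarith [mul_nonneg (by linarith : 0 ≤ δ₀ - κt - 1 - κ₀) (by linarith : 0 ≤ t - 1), hκt]
      calc 2 ^ 4 * 5 * Real.exp t * (c * Real.exp (-(δ₀ * t)) * (1 / γ) * Real.exp (κt * (t + (CB + 3))))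
          = (2 ^ 4 * 5) * (c * (1 / γ)) * (Real.exp t * (Real.exp (-(δ₀ * t)) * Real.exp (κt * (t + (CB + 3))))) := by ring
        _ ≤ (2 ^ 4 * 5) * (c * (1 / γ)) * (Real.exp (-(κ₀ * t)) * (Real.exp (κt * (CB + 4)) * Real.exp (-(δ₀ - κt - 1 - κ₀)))) :=
            mul_le_mul_of_nonneg_left hexp (by positivity)
        _ = Real.exp (-(κ₀ * t)) * ((2 ^ 4 * 5) * Real.exp (κt * (CB + 4)) * Afar) := by rw [hAfar]; ring
        _ ≤ Real.exp (-(κ₀ * t)) * ((2 ^ 4 * 5) * Real.exp (κt * (CB + 4)) * (Afar + Anear)) := by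
            refine mul_le_mul_of_nonneg_left (mul_le_mul_of_nonneg_left (by linarith) (by positivity)) (Real.exp_pos _).le
    · -- near: `t < 1`: `t + κt(t + CB + 3) ≤ −κ₀ t + κt(CB + 4) + 1 + κ₀`
      have ht1 : t < 1 := lt_of_not_ge hfar
      have hexp : Real.exp t * Real.exp (κt * (t + (CB + 3))) ≤ Real.exp (-(κ₀ * t)) * (Real.exp (κt * (CB + 4)) * Real.exp (1 + κ₀)) := by
        rw [← Real.exp_add, ← Real.exp_add, ← Real.exp_add]
        apply Real.exp_le_exp.2
        nlinarith [mul_nonneg (by linarith : 0 ≤ κt + 1 + κ₀) (by linarith : 0 ≤ 1 - t)]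
      calc 2 ^ 4 * 5 * Real.exp t * (c * Nn * Real.exp (κt * (t + (CB + 3))))
          = (2 ^ 4 * 5) * (c * Nn) * (Real.exp t * Real.exp (κt * (t + (CB + 3)))) := by ring
        _ ≤ (2 ^ 4 * 5) * (c * Nn) * (Real.exp (-(κ₀ * t)) * (Real.exp (κt * (CB + 4)) * Real.exp (1 + κ₀))) :=
            mul_le_mul_of_nonneg_left hexp (by positivity)
        _ = Real.exp (-(κ₀ * t)) * ((2 ^ 4 * 5) * Real.exp (κt * (CB + 4)) * Anear) := by rw [hAnear]; ring
        _ ≤ Real.exp (-(κ₀ * t)) * ((2 ^ 4 * 5) * Real.exp (κt * (CB + 4)) * (Afar + Anear)) := by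
            refine mul_le_mul_of_nonneg_left (mul_le_mul_of_nonneg_left (by linarith) (by positivity)) (Real.exp_pos _).le
  -- assemble
  calc ∑ q : TPt (F.P K).d (Sect2.domCount (F.P K) Mc (k + 1)), g3cStepWt F Mc k K c γ δ₀ κ' κt a (q, Y)
      ≤ CB * (Y.1 : Finset _).card * (G * Real.exp (κt * (t + (CB + 3)))) := hsum1
    _ ≤ CB * (2 ^ 4 * 5 * Real.exp t) * (G * Real.exp (κt * (t + (CB + 3)))) :=
        mul_le_mul_of_nonneg_right (mul_le_mul_of_nonneg_left hcard (by positivity)) (by positivity)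
    _ = CB * ((2 ^ 4 * 5 * Real.exp t) * (G * Real.exp (κt * (t + (CB + 3))))) := by ring
    _ ≤ CB * (Real.exp (-(κ₀ * t)) * ((2 ^ 4 * 5) * Real.exp (κt * (CB + 4)) * (Afar + Anear))) := mul_le_mul_of_nonneg_left hkey (by positivity)
    _ = Real.exp (-(κ₀ * t)) * ((CB * (2 ^ 4 * 5)) * Real.exp (κt * (CB + 4)) * (Afar + Anear)) := by ring
    _ = _ := by rw [hAfar, hAnear]

/-- ★★ **THE ONE-STEP SUM BOUND `Σ_s f(a; s) ≤ Λ`** (for `δ₀ ≥ κ₀ + κt + 1`, `κt ≥ 0`). [cite: Balaban1985UV3, (25) p.262; Balaban1988RG2Cluster, (1.26) p.8] -/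
theorem sum_g3cStepWt_le (Mc k K : ℕ) {c γ δ₀ κt : ℝ} (κ' : ℝ) (hc : 0 ≤ c) (hγ : 0 < γ) (hκt : 0 ≤ κt)
    (hδ₀ : kappa₀ (4 * 2 ^ 4) (2 * 4) + κt + 1 ≤ δ₀) (a : TPt (F.P K).d (Sect2.domCount (F.P K) Mc (k + 1))) :
    ∑ s : TPt (F.P K).d (Sect2.domCount (F.P K) Mc (k + 1)) × (recordDomSys F Mc k K).Dom, g3cStepWt F Mc k K c γ δ₀ κ' κt a s ≤ g3cLam F Mc c γ δ₀ κ' κt := by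
  set M : ℝ := ((((3 ^ 4 * 3 ^ 4 : ℕ) : ℝ) * (2 ^ 4 * 5)) * Real.exp (κt * (((3 ^ 4 * 3 ^ 4 : ℕ) : ℝ) + 4)) *
          (c * (1 / γ) * Real.exp (-(δ₀ - κt - 1 - kappa₀ (4 * 2 ^ 4) (2 * 4))) +
            Real.exp (1 + kappa₀ (4 * 2 ^ 4) (2 * 4)) *
              (c * (((3 ^ 4 * 3 ^ 4 * (3 * 4 * (F.L * Mc) ^ 4) : ℕ) : ℝ) * (Real.exp (-(κ' * ((F.L * Mc : ℕ) : ℝ))) / (γ / 2)))))) with hM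
  have hM0 : 0 ≤ M := by positivity
  rw [Fintype.sum_prod_type_right]
  calc ∑ Y : (recordDomSys F Mc k K).Dom, ∑ q : TPt (F.P K).d (Sect2.domCount (F.P K) Mc (k + 1)), g3cStepWt F Mc k K c γ δ₀ κ' κt a (q, Y)
      ≤ ∑ Y : (recordDomSys F Mc k K).Dom,
          (if a ∈ (Y.1 : Finset _) then Real.exp (-(kappa₀ (4 * 2 ^ 4) (2 * 4) * torusTreeLen (Y.1 : Finset _))) else 0) * M :=
        Finset.sum_le_sum fun Y _ => sum_g3cStepWt_snd_le Mc k K κ' hc hγ hκt hδ₀ a Y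
    _ = (∑ Y : (recordDomSys F Mc k K).Dom,
          (if a ∈ (Y.1 : Finset _) then 1 * Real.exp (-(kappa₀ (4 * 2 ^ 4) (2 * 4) * torusTreeLen (Y.1 : Finset _))) else 0)) * M := by
        rw [Finset.sum_mul]; simp only [one_mul]
    _ ≤ (1 * K₀ (4 * 2 ^ 4) (2 * 4)) * M := by
        refine mul_le_mul_of_nonneg_right ?_ hM0
        have h := G3CGeom.sum_ite_mem_le (d := 4) (N := Sect2.domCount (F.P K) Mc (k + 1)) a (c₀ := (1 : ℝ)) zero_le_one le_rfl
          (Finset.univ : Finset (recordDomSys F Mc k K).Dom)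
        exact h
    _ = g3cLam F Mc c γ δ₀ κ' κt := by rw [g3cLam, hM]; ring

end StepSum

/-! ## §3  The thresholds `δG`, `Mth'` -/

section Thresholds

variable (F : T4Family)

/-- `A·e^{−4A} ≤ ¼` (`e^x ≥ 1 + x`). [folklore] -/
theorem mul_exp_neg_four_mul_le (A : ℝ) : A * Real.exp (-(4 * A)) ≤ 1 / 4 := by
  have h1 : 1 + 4 * A ≤ Real.exp (4 * A) := by have := Real.add_one_le_exp (4 * A); linarith
  have h2 : 0 < Real.exp (4 * A) := Real.exp_pos _
  rw [Real.exp_neg]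
  rw [mul_inv_le_iff₀ h2]
  nlinarith

/-- `y^4·e^{−y} ≤ 120/y` for `y > 0` (`y^5/5! ≤ e^y`). [folklore] -/
theorem pow_four_mul_exp_neg_le {y : ℝ} (hy : 0 < y) : y ^ 4 * Real.exp (-y) ≤ 120 / y := by
  have h := Real.pow_div_factorial_le_exp y hy.le 5
  have h5 : ((Nat.factorial 5 : ℕ) : ℝ) = 120 := by norm_num [Nat.factorial]
  rw [h5] at h
  rw [Real.exp_neg, div_eq_mul_inv]
  have hexp := Real.exp_pos y
  rw [div_le_iff₀ (by norm_num : (0 : ℝ) < 120)] at h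
  -- y^4 e^{-y} ≤ 120 y⁻¹  ⟸  y^5 ≤ 120 e^y
  have : y ^ 4 * (Real.exp y)⁻¹ * y ≤ 120 := by
    rw [mul_comm, ← mul_assoc, mul_inv_le_iff₀ hexp]
    have e5 : y * y ^ 4 = y ^ 5 := by ring
    rw [e5]; linarith
  calc y ^ 4 * (Real.exp y)⁻¹ = (y ^ 4 * (Real.exp y)⁻¹ * y) * y⁻¹ := by field_simp
    _ ≤ 120 * y⁻¹ := mul_le_mul_of_nonneg_right this (inv_nonneg.2 hy.le)

/-- ★ **THE THRESHOLDS**: for `κt ≥ 0`, `c ≥ 0`, `γ > 0`, `κ′ > 0` there are `δG > 0` and `Mth'` (depending on these only) with `Λ(c, γ, δ₀, κ′, κt, Mc) ≤ ½` and `κ₀ + κt + 1 ≤ δ₀` whenever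
`δ₀ ≥ δG` and `Mc ≥ Mth'` — «κ can be arbitrarily large if M is sufficiently large» ([16] p.262). [cite: Balaban1985UV3, (25) p.262 and the remark after it] -/
theorem exists_thresholds_g3cLam {c γ κ' κt : ℝ} (hc : 0 ≤ c) (hγ : 0 < γ) (hκ' : 0 < κ') (hκt : 0 ≤ κt) :
    ∃ δG : ℝ, 0 < δG ∧ ∃ Mth' : ℕ, ∀ δ₀ : ℝ, δG ≤ δ₀ → ∀ Mc : ℕ, Mth' ≤ Mc →
      g3cLam F Mc c γ δ₀ κ' κt ≤ 1 / 2 ∧ kappa₀ (4 * 2 ^ 4) (2 * 4) + κt + 1 ≤ δ₀ := by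
  have hκ0 : 0 ≤ kappa₀ (4 * 2 ^ 4) (2 * 4) := kappa₀_nonneg (by norm_num) _
  set P : ℝ := K₀ (4 * 2 ^ 4) (2 * 4) * (((3 ^ 4 * 3 ^ 4 : ℕ) : ℝ) * (2 ^ 4 * 5)) * Real.exp (κt * (((3 ^ 4 * 3 ^ 4 : ℕ) : ℝ) + 4)) with hPdef
  have hP0 : 0 < P := by have := K₀_pos (4 * 2 ^ 4 : ℝ) (2 * 4); positivity
  -- far half: A := P·c/γ
  set A : ℝ := P * (c * (1 / γ)) with hAdef
  have hA0 : 0 ≤ A := by positivity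
  -- near half: B := P·e^{1+kappa₀ (4 * 2 ^ 4) (2 * 4)}·c·3^8·12·L^4/(γ/2) ; the near term is B·Mc^4·e^{−κ′ L Mc} ≤ B·120/(κ′^5·L·Mc)·(1/L^3) … we bound crudely with `L ≥ 1`
  set B : ℝ := P * (Real.exp (1 + kappa₀ (4 * 2 ^ 4) (2 * 4)) * (c * ((3 ^ 4 * 3 ^ 4 * (3 * 4) : ℕ) : ℝ) / (γ / 2))) with hBdef
  have hB0 : 0 ≤ B := by positivity
  have hL1 : (1 : ℝ) ≤ F.L := by exact_mod_cast F.hL.2.le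
  refine ⟨kappa₀ (4 * 2 ^ 4) (2 * 4) + κt + 1 + 4 * A, by positivity, Nat.ceil (4 * B * 120 / κ' ^ 5) + 1, fun δ₀ hδ₀ Mc hMc => ⟨?_, by linarith⟩⟩
  have hMc1 : (1 : ℝ) ≤ Mc := by
    have : 1 ≤ Mc := le_trans (Nat.le_add_left 1 _) hMc
    exact_mod_cast this
  have hMcB : 4 * B * 120 / κ' ^ 5 ≤ (Mc : ℝ) - 1 := by
    have h1 : (Nat.ceil (4 * B * 120 / κ' ^ 5) : ℝ) + 1 ≤ Mc := by exact_mod_cast hMc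
    linarith [Nat.le_ceil (4 * B * 120 / κ' ^ 5)]
  -- far
  have hfar : P * (c * (1 / γ) * Real.exp (-(δ₀ - κt - 1 - kappa₀ (4 * 2 ^ 4) (2 * 4)))) ≤ 1 / 4 := by
    have h1 : Real.exp (-(δ₀ - κt - 1 - kappa₀ (4 * 2 ^ 4) (2 * 4))) ≤ Real.exp (-(4 * A)) := Real.exp_le_exp.2 (by linarith)
    calc P * (c * (1 / γ) * Real.exp (-(δ₀ - κt - 1 - kappa₀ (4 * 2 ^ 4) (2 * 4)))) = A * Real.exp (-(δ₀ - κt - 1 - kappa₀ (4 * 2 ^ 4) (2 * 4))) := by rw [hAdef]; ring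
      _ ≤ A * Real.exp (-(4 * A)) := mul_le_mul_of_nonneg_left h1 hA0
      _ ≤ 1 / 4 := mul_exp_neg_four_mul_le A
  -- near
  have hnear : P * (Real.exp (1 + kappa₀ (4 * 2 ^ 4) (2 * 4)) * (c * (((3 ^ 4 * 3 ^ 4 * (3 * 4 * (F.L * Mc) ^ 4) : ℕ) : ℝ) *
      (Real.exp (-(κ' * ((F.L * Mc : ℕ) : ℝ))) / (γ / 2))))) ≤ 1 / 4 := by
    set y : ℝ := κ' * ((F.L * Mc : ℕ) : ℝ) with hydef
    have hLM : (1 : ℝ) ≤ ((F.L * Mc : ℕ) : ℝ) := by push_cast; nlinarith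
    have hy : 0 < y := by positivity
    have hcast : (((3 ^ 4 * 3 ^ 4 * (3 * 4 * (F.L * Mc) ^ 4) : ℕ) : ℝ)) = ((3 ^ 4 * 3 ^ 4 * (3 * 4) : ℕ) : ℝ) * ((F.L * Mc : ℕ) : ℝ) ^ 4 := by push_cast; ring
    have hpow : ((F.L * Mc : ℕ) : ℝ) ^ 4 * Real.exp (-y) ≤ 120 / (κ' ^ 5 * ((F.L * Mc : ℕ) : ℝ)) := by
      have h := pow_four_mul_exp_neg_le hy
      have hκ4 : 0 < κ' ^ 4 := by positivity
      -- (LMc)^4 e^{-y} = y^4 e^{-y} / κ'^4 ≤ (120 / y) / κ'^4 = 120 / (κ'^5 LMc)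
      have e1 : ((F.L * Mc : ℕ) : ℝ) ^ 4 * Real.exp (-y) = (y ^ 4 * Real.exp (-y)) / κ' ^ 4 := by
        rw [hydef]; field_simp
      rw [e1, div_le_iff₀ hκ4]
      calc y ^ 4 * Real.exp (-y) ≤ 120 / y := h
        _ = 120 / (κ' ^ 5 * ((F.L * Mc : ℕ) : ℝ)) * κ' ^ 4 := by rw [hydef]; field_simp
    have hstep : ((F.L * Mc : ℕ) : ℝ) ^ 4 * Real.exp (-y) ≤ 120 / (κ' ^ 5 * (Mc : ℝ)) := by
      refine hpow.trans (div_le_div_of_nonneg_left (by norm_num) (mul_pos (pow_pos hκ' 5) (by linarith [hMc1])) ?_)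
      push_cast
      have hMc0 : (0 : ℝ) ≤ Mc := Nat.cast_nonneg Mc
      have hLMc : (Mc : ℝ) ≤ F.L * Mc := by nlinarith
      exact mul_le_mul_of_nonneg_left hLMc (by positivity)
    calc P * (Real.exp (1 + kappa₀ (4 * 2 ^ 4) (2 * 4)) * (c * (((3 ^ 4 * 3 ^ 4 * (3 * 4 * (F.L * Mc) ^ 4) : ℕ) : ℝ) * (Real.exp (-y) / (γ / 2)))))
        = B * (((F.L * Mc : ℕ) : ℝ) ^ 4 * Real.exp (-y)) := by rw [hBdef, hcast]; ring
      _ ≤ B * (120 / (κ' ^ 5 * (Mc : ℝ))) := mul_le_mul_of_nonneg_left hstep hB0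
      _ ≤ 1 / 4 := by
          rw [mul_div_assoc', div_le_iff₀ (by positivity : (0 : ℝ) < κ' ^ 5 * Mc)]
          have : 4 * B * 120 ≤ κ' ^ 5 * ((Mc : ℝ) - 1) := by
            have := mul_le_mul_of_nonneg_left hMcB (by positivity : (0 : ℝ) ≤ κ' ^ 5)
            rwa [mul_div_cancel₀ _ (by positivity : κ' ^ 5 ≠ 0)] at this
          nlinarith [(by positivity : (0 : ℝ) ≤ κ' ^ 5)]
  calc g3cLam F Mc c γ δ₀ κ' κt
      = P * (c * (1 / γ) * Real.exp (-(δ₀ - κt - 1 - kappa₀ (4 * 2 ^ 4) (2 * 4)))) +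
          P * (Real.exp (1 + kappa₀ (4 * 2 ^ 4) (2 * 4)) * (c * (((3 ^ 4 * 3 ^ 4 * (3 * 4 * (F.L * Mc) ^ 4) : ℕ) : ℝ) * (Real.exp (-(κ' * ((F.L * Mc : ℕ) : ℝ))) / (γ / 2))))) := by
        rw [g3cLam, hPdef]; ring
    _ ≤ 1 / 4 + 1 / 4 := add_le_add hfar hnear
    _ = 1 / 2 := by norm_num

end Thresholds

end Summit.QuantumFields.YangMills.Theorems.BalabanUVNodesPortS1

end
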